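import Summits.BirchSwinnertonDyer.BirchSwinnertonDyer.Theorems.Rank1ResidualJetTildeClassLevelLink
import Summits.BirchSwinnertonDyer.BirchSwinnertonDyer.Theorems.Rank1ResidualJetKolyvaginDecompositionTrivial
import Summits.BirchSwinnertonDyer.BirchSwinnertonDyer.Theorems.KolyvaginRankRigidityAtTwoRingClassNoTwoTorsion
import Summits.BirchSwinnertonDyer.BirchSwinnertonDyer.Theorems.ErratumRoadFiveNonSurjCornerKolyJProp44StandingInputs
import Literature.NumberTheory.EllipticCurves.HeegnerPointsOfConductor
import HarnessLib

/-!
# Crux V2♭ₘ `KolyvaginCorankLowerBoundAtTwoMargin` (stmt-BirchSwinnertonDyer-27015 ← 24623), line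
# `kolyvagin_depth_split` (lead g7 RESHAPE 3, `windowsTheta_of_swap`): REGISTERED STUB (S3)
# `stub_localOrderLevelUpAtTwo` — LOCAL ORDERS OF `c_M(n)` AT A FRESH KOLYVAGIN PRIME GO UP WITH
# THE LEVEL (helper, PROVED, unconditional; width seat `bsd-line-krr2-p2` g6)

(S3) = hypothesis `hlocUp` of the lead's `windowsTheta_of_swap`: for a Kolyvagin–Heegner datum `dat`
of conductor `n ∈ Λ` on V2♭'s habitat and frame, `1 ≤ M ≤ M' ≤ M(n)`, a Zhang–Kolyvagin prime `q ∤ n`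
at `2` with `M' ≤ M(q)` and its place `v ∋ q`:
`2^j c_M(n) ∉ ker loc_v ⟹ 2^{j + (M' - M)} c_{M'}(n) ∉ ker loc_v`.
Three tree inputs, nothing new: (i) the change of level `ι_* : H¹(K, E[2^M]) → H¹(K, E[2^{M'}])` sends
`c_M(n)` to `2^{M'-M} c_{M'}(n)` (x11b3/stepL `Koly.torsionH1OfDvd_kolyvaginClass_of_zsmul` +
`kolyvaginClass_zsmul_add_zsmul_eq`, as in JET's `addOrderOf_localization_kolyvaginClass_of_rootClass`),
both classes being McCallum's classes of `P(n)` (standing inputs on the habitat: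
`KolyvaginRankRigidity.KolyvaginHeegnerData.isAdmissible_pointsSubgroup_two`,
`Prop44.toGeomPoints_derivedPoint_mem_invPoints`); (ii) `Γ_{K_v}` fixes `E[2^{M'}]` at a Zhang–Kolyvagin
prime of index `≥ M'` (JET `GlobalDuality.decompositionSubgroup_le_torsionFixing`: Cayley–Hamilton
`Fr² = a_q Fr − q ≡ 1` on `T₂E`, any prime `p`, so `p = 2`); (iii) at such a place local vanishing is
invariant under `ι_*` (`mem_torsionLocalKer_iff_torsionH1OfDvd_mem`). HONEST FRAMING: stub credit for
27015 (`--supports`); V2♭ₘ / T5⁺ NOT proved; BSD is not proved by any of this.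

References: [McCallumLMS1991] §3 (3), §4 (4)–(6), Lemma 4.6; [GrossLMS1991] §4 (4.2)–(4.6), Prop. 9.6;
[WZhang2014] Notations (xii).
-/

set_option autoImplicit false
-- the Theorems namespace of this sub repeats the summit name by design (D-0017 nested layout)
set_option linter.dupNamespace false

noncomputable section

open scoped Classical NumberField

namespace Summit.BirchSwinnertonDyer.BirchSwinnertonDyer.Theorems.KolyvaginLowerBoundAtTwo

open WeierstrassCurve Field NumberField IsDedekindDomain
open Literature.NumberTheory.GaloisRepresentations Literature.NumberTheory.EllipticCurves
  Literature.NumberTheory.EllipticCurves.ModularForms Literature.NumberTheory.EllipticCurves.KolyvaginCocycle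
open Summit.BirchSwinnertonDyer.Rank1Residual.X11b.Three

set_option maxHeartbeats 800000 in
/-- **(S3) REGISTERED STUB `stub_localOrderLevelUpAtTwo`: local orders of Kolyvagin classes at a fresh
Kolyvagin prime go up with the level.** See the module docstring. [cite: McCallumLMS1991, §3 (3),
§4 Lemma 4.6] [cite: GrossLMS1991, Prop. 9.6] [cite: WZhang2014, Notations (xii)] -/
theorem stub_localOrderLevelUpAtTwo : ∀ (W : WeierstrassCurve ℚ) [W.IsElliptic] [W.IsGloballyMinimal], ¬ W.HasCM → (Rank1Residual.GoodOrd W 2 ∨ Rank1Residual.Mult W 2) → (∀ m : ℕ, W.HasSurjectiveModNGaloisRep (2 ^ m : ℕ)) → ∀ (K : Type) [Field K] [NumberField K], IsImaginaryQuadratic K → NumberField.discr K ≠ -3 → NumberField.discr K ≠ -4 → ¬ ((2 : ℤ) ∣ NumberField.discr K) → ∀ [NeZero (W.conductorNorm ℤ)], SatisfiesHeegnerHypothesis (W.conductorNorm ℤ) K → ∀ (Dt : ModularParametrizationData W (W.conductorNorm ℤ)) (β : ℤ) (ι : K →+* ℂ), ∀ (n : ℕ) (dat : KolyvaginHeegnerData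 Dt β ι n) (M M' j q : ℕ) (v : HeightOneSpectrum (𝓞 K)), KolyvaginDescent.KolSupp (Zhang2014.IsKolyvaginPrime (W.conductorNorm ℤ) W K 2) n → 1 ≤ M → M ≤ M' → (M' : ℕ∞) ≤ Zhang2014.levelIndex W 2 n → Zhang2014.IsKolyvaginPrime (W.conductorNorm ℤ) W K 2 q → M' ≤ Zhang2014.kolyvaginIndex W 2 q → ¬ q ∣ n → ((q : ℕ) : 𝓞 K) ∈ v.asIdeal → ((2 ^ j : ℕ) : ℤ) • dat.kolyvaginClass Nat.prime_two M ∉ (W.baseChange K).torsionLocalKer (v.adicCompletion K) ((2 ^ M : ℕ) : ℤ) → ((2 ^ (j + (M' - M)) : ℕ) : ℤ) • dat.kolyvaginClass Nat.prime_two M' ∉ (W.baseChange K).torsionLocalKer (v.adicCompletion K) ((2 ^ M' : ℕ) : ℤ) := by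
  intro W _ _ hCM hred hsur K _ _ hK hne3 hne4 h2d _ hHN Dt β ι n dat M M' j q v hn hM1 hMM' hlev' hq
    hqidx hqn hv hloc
  classical
  haveI : Fact (Nat.Prime 2) := ⟨Nat.prime_two⟩
  haveI : (W.baseChange K).IsElliptic := by rw [baseChange]; infer_instance
  have hs : W.HasSurjectiveModNGaloisRep 2 := by simpa using hsur 1
  obtain ⟨s, rfl⟩ : ∃ s, M' = M + s := ⟨M' - M, by omega⟩
  -- ### standing inputs of McCallum's class at both levels (habitat)
  have hn0 : n ≠ 0 := hn.1.ne_zero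
  have h2n : ¬ 2 ∣ n := fun h2 ↦
    (hn.2 2 (Nat.mem_primeFactors.mpr ⟨Nat.prime_two, h2, hn0⟩)).2.2.2.1 rfl
  have hcop : Nat.Coprime (W.conductorNorm ℤ) n :=
    Nat.coprime_of_dvd fun k hk hkN hkn ↦
      (hn.2 k (Nat.mem_primeFactors.mpr ⟨hk, hkn, hn0⟩)).2.1 hkN
  have hA : ∀ L : ℕ, IsAdmissible (absoluteGaloisGroup K) dat.pointsSubgroup ((2 ^ L : ℕ) : ℤ) :=
    fun L ↦ KolyvaginRankRigidity.isAdmissible_pointsSubgroup_two dat hs hK h2d hHN hn0 h2n hcop L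
  have hD : NumberField.discr K < -4 := by
    have hneg : NumberField.discr K < 0 := hK.discr_neg
    have h2 : 2 < |NumberField.discr K| :=
      NumberField.abs_discr_gt_two (by rw [hK.1]; exact one_lt_two)
    rw [abs_of_neg hneg] at h2
    have hodd : Odd (NumberField.discr K) := by
      rcases Int.even_or_odd (NumberField.discr K) with h | h
      · exact absurd (even_iff_two_dvd.mp h) h2d
      · exact h
    obtain ⟨k, hk⟩ := hodd
    omega
  have hP : ∀ L : ℕ, (L : ℕ∞) ≤ Zhang2014.levelIndex W 2 n →
      dat.toGeomPoints dat.derivedPoint ∈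
        invPoints (absoluteGaloisGroup K) dat.pointsSubgroup ((2 ^ L : ℕ) : ℤ) := fun L hL ↦
    Theorems.Prop44.toGeomPoints_derivedPoint_mem_invPoints hK ι hD hHN Dt Nat.prime_two hn.1
      (fun q hq ↦ ⟨hn.2 q hq, (Zhang2014.natCast_le_levelIndex_iff.mp hL) q hq⟩) dat
  have hlevM : (M : ℕ∞) ≤ Zhang2014.levelIndex W 2 n := le_trans (by exact_mod_cast hMM') hlev'
  have hκ₁ := dat.kolyvaginClass_of_admissible Nat.prime_two M (hA M) (hP M hlevM)
  have hκ₂ := dat.kolyvaginClass_of_admissible Nat.prime_two (M + s) (hA (M + s)) (hP (M + s) hlev')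
  -- ### `ι_* c_M(n) = 2^s · c_{M+s}(n)`
  have hdvdN : 2 ^ M ∣ 2 ^ (M + s) := pow_dvd_pow 2 (Nat.le_add_right M s)
  have hdvdZ : ((2 ^ M : ℕ) : ℤ) ∣ ((2 ^ (M + s) : ℕ) : ℤ) := Int.natCast_dvd_natCast.mpr hdvdN
  have hnm : ((2 ^ (M + s) : ℕ) : ℤ) = ((2 ^ s : ℕ) : ℤ) * ((2 ^ M : ℕ) : ℤ) := by
    push_cast; ring
  have hPQ : ((2 ^ s : ℕ) : ℤ) • dat.toGeomPoints dat.derivedPoint =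
      ((2 ^ s : ℕ) : ℤ) • dat.toGeomPoints dat.derivedPoint +
        ((2 ^ (M + s) : ℕ) : ℤ) • (0 : geomPoints (W.baseChange K)) := by
    rw [smul_zero, add_zero]
  have hP' : ((2 ^ s : ℕ) : ℤ) • dat.toGeomPoints dat.derivedPoint +
        ((2 ^ (M + s) : ℕ) : ℤ) • (0 : geomPoints (W.baseChange K)) ∈
      invPoints (absoluteGaloisGroup K) dat.pointsSubgroup ((2 ^ (M + s) : ℕ) : ℤ) := by
    rw [smul_zero, add_zero]; exact (invPoints _ _ _).zsmul_mem (hP (M + s) hlev') _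
  have hι := Koly.torsionH1OfDvd_kolyvaginClass_of_zsmul (W.baseChange K) hdvdZ hnm
    ((W.baseChange K).zsmul_geomPoints_surjective_of_charZero
      (by exact_mod_cast pow_ne_zero M Nat.prime_two.ne_zero))
    ((W.baseChange K).zsmul_geomPoints_surjective_of_charZero
      (by exact_mod_cast pow_ne_zero (M + s) Nat.prime_two.ne_zero))
    (hA M) (hA (M + s)) (hP M hlevM) hPQ hP'
  have hlin := Summit.BirchSwinnertonDyer.BirchSwinnertonDyer.Theorems.kolyvaginClass_zsmul_add_zsmul_eq
    (hdiv := (W.baseChange K).zsmul_geomPoints_surjective_of_charZero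
      (by exact_mod_cast pow_ne_zero (M + s) Nat.prime_two.ne_zero))
    (hA (M + s)) (hP (M + s) hlev') ((2 ^ s : ℕ) : ℤ) (dat.pointsSubgroup.zero_mem) hP'
  rw [hlin, ← hκ₂, ← hκ₁] at hι
  -- `hι : ι_* (c_M(n)) = 2^s • c_{M+s}(n)`
  -- ### `Γ_{K_v}` fixes `E[2^{M+s}]` (Zhang–Kolyvagin prime of index `≥ M + s`)
  have htriv : ∀ (g : absoluteGaloisGroup (v.adicCompletion K))
      (Q : geomTorsion (W.baseChange K) ((2 ^ (M + s) : ℕ) : ℤ)),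
      resGal (K := K) (v.adicCompletion K) g • Q = Q := fun g Q ↦ by
    rw [resGal_eq_absGaloisRestrict]
    have hd : absGaloisRestrict K (v.adicCompletion K) g ∈
        (adicCompletionPrime K v).decompositionSubgroup (absoluteGaloisGroup K) := by
      rw [decompositionSubgroup_adicCompletionPrime_eq_range]; exact ⟨g, rfl⟩
    exact smul_eq_of_mem_torsionFixing _ _
      (Summit.BirchSwinnertonDyer.Rank1Residual.JET.GlobalDuality.decompositionSubgroup_le_torsionFixing
        W K hK hq hqidx v hv (adicCompletionPrime_mem_primesAbove K v) hd) Q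
  -- ### local vanishing is invariant under `ι_*` at `v`
  have e := mem_torsionLocalKer_iff_torsionH1OfDvd_mem (W.baseChange K) (v.adicCompletion K) hdvdN
    (pow_ne_zero M Nat.prime_two.ne_zero) (pow_ne_zero (M + s) Nat.prime_two.ne_zero) htriv
    (((2 ^ j : ℕ) : ℤ) • dat.kolyvaginClass Nat.prime_two M)
  intro hmem
  apply hloc
  rw [e, map_zsmul]
  have hι' : torsionH1OfDvd (W.baseChange K) (Int.natCast_dvd_natCast.mpr hdvdN)
      (dat.kolyvaginClass Nat.prime_two M) = ((2 ^ s : ℕ) : ℤ) • dat.kolyvaginClass Nat.prime_two (M + s) :=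
    hι
  rw [hι', smul_smul, ← Nat.cast_mul, ← pow_add, show j + s = j + (M + s - M) by omega]
  exact hmem

end Summit.BirchSwinnertonDyer.BirchSwinnertonDyer.Theorems.KolyvaginLowerBoundAtTwo

end
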